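import Literature.Analysis.FluidPDE.FluidComputer.ThresholdCertificate
import Literature.Analysis.FluidPDE.FluidComputer.ThresholdCrossing
import Literature.Analysis.FluidPDE.FluidComputer.CertificateComposition
import Literature.Analysis.FluidPDE.FluidComputer.CertificateRefinement
import Literature.Analysis.FluidPDE.FluidComputer.CertificateContinuation
import HarnessLib

/-!
# Fluid computer blueprint — the threshold gate: stages 1–2 composed (pre-threshold ∘ crossing)

HONEST FRAMING: low prior, high value-of-information experiment on Tao's machine paradigm; NOT a
claim that NS blows up. This file is finite-dimensional and elementary: it assembles, from pieces
already in the library, the certificate of the reach layer's interface (`ReachCertificate`) for the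
FIRST TWO stages of the threshold gate's cycle — pre-threshold (`ThresholdCertificate.lean`) then
crossing (`ThresholdCrossing.lean`) — over the bare energy ball, with every seam condition of
`ReachCertificate.comp` (`CertificateComposition.lean`) discharged. Nothing fluid-side.

## What it shows

That the generic glue does its job on a real gate: the two stages are certified separately over
(possibly different, thin) loaded regions `preRegion a₀ R`, `preRegion a₁ R₁`; each is refined by
the sign condition `c ≥ 0` (`IsPreThresholdCurve.trigger_nonneg`, needs `δ < σa₀²` and `c ≥ 0` on
the input region) via `ReachCertificate.restrictConst`, retargeted to its end-of-stage tubes via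
`withHandoff`, moved to the common energy ball `modeBall Rb` via `enlarge` (continuation principle,
`CertificateContinuation.lean` — the loaded regions are open), and composed via `comp`: hand-off by
construction, compact hand-off tubes (`isCompact_preTube`), and joint closedness of the crossing
boxes in (hand-off point, time, state) (`isClosed_boxTube_joint`, finitely many inequalities jointly
continuous). The result `preCrossCertificate` is ONE certificate of length `T₁ + T₂` from the
loaded input region to the crossing stage's sign-refined hand-off boxes — the input data of the
ignition theorem `ThresholdIgnition.lean`.

## What it is NOT

Not the full cycle: the final stage (ignition + transfer over the energy ball, existential REACH)
is open on its transfer half exactly as recorded in `ThresholdGate.lean` / `ThresholdCrossing.lean`.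
The crossing-stage hypotheses are stated for every point of the stage-1 hand-off (as real
inequalities to be discharged by the user from the stage-1 tube bounds), not derived here.
[cite: Tao2016AveragedNS, §5.5 Thm 5.3 (5.5); §1.3 pp. 10–11]
-/

noncomputable section

open Set Filter Topology
open scoped NNReal

namespace Literature.Analysis.FluidPDE.FluidComputer

open Literature.Analysis.FluidPDE.Tao2016AveragedNS Literature.Analysis.ODE

variable {ε σ ν μ r κ δ a₀ R : ℝ}

/-! ### §1. Regions -/

/-- The bare **energy ball** of the five modes: every mode below `R` in absolute value (no carrier
floor). [folklore] -/
def modeBall (R : ℝ) : Set (Fin 5 → ℝ) := {X | ∀ i, |X i| < R}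

/-- The energy ball is open. [folklore] -/
theorem isOpen_modeBall (R : ℝ) : IsOpen (modeBall R) := by
  have h : IsOpen (⋂ i, {X : Fin 5 → ℝ | |X i| < R}) :=
    isOpen_iInter_of_finite fun i => isOpen_lt (continuous_apply i).abs continuous_const
  convert h using 1
  ext X; simp [modeBall]

/-- The energy ball is monotone in the radius. [folklore] -/
theorem modeBall_mono {R R' : ℝ} (h : R ≤ R') : modeBall R ⊆ modeBall R' :=
  fun _ hX i => (hX i).trans_le h

/-- A loaded region lies in the energy ball of the same radius. [folklore] -/
theorem preRegion_subset_modeBall (a₀ R : ℝ) : preRegion a₀ R ⊆ modeBall R := fun _ hX => hX.2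

/-- The closed half-space of **non-negative trigger**. [folklore] -/
def trigNonneg : Set (Fin 5 → ℝ) := {X | 0 ≤ X 2}

/-- It is closed. [folklore] -/
theorem isClosed_trigNonneg : IsClosed trigNonneg :=
  isClosed_le continuous_const (continuous_apply 2)

/-! ### §2. The sign refinement `c ≥ 0` of any stage certificate of the threshold gate -/

/-- Along every admissible curve of the threshold gate in a loaded region, a non-negative initial
trigger stays non-negative (`IsPreThresholdCurve.trigger_nonneg`), in the form the refinement
combinator `ReachCertificate.restrictConst` consumes. Needs `δ < σa₀²`. [folklore] -/
theorem trigNonneg_cert (hσ : 0 ≤ σ) (ha₀ : 0 ≤ a₀) (hs : δ < σ * a₀ ^ 2)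
    {Ain : Set (Fin 5 → ℝ)} (hAin : Ain ⊆ trigNonneg) (τc : ℝ) :
    ∀ p ∈ Ain, ∀ (σT : ℝ) (x : ℝ → Fin 5 → ℝ), 0 ≤ σT → σT ≤ τc → x 0 = p →
      ContinuousOn x (Icc 0 σT) → (∀ s ∈ Ico 0 σT, x s ∈ preRegion a₀ R) →
        (∀ s ∈ Ico 0 σT, ∃ W : Fin 5 → ℝ, HasDerivWithinAt x W (Ici s) s ∧
          ‖W - thresholdCircuit ε σ ν μ r κ (x s)‖ ≤ δ) →
          x σT ∈ trigNonneg := by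
  intro p hp σT x h0 _ hx0 hcont hU hder
  have hc0 : 0 ≤ x 0 2 := by rw [hx0]; exact hAin hp
  have hc : IsPreThresholdCurve ε σ ν μ r κ δ a₀ R σT x := ⟨hcont, hU, hder⟩
  exact hc.trigger_nonneg hσ ha₀ hs hc0 σT ⟨h0, le_rfl⟩

/-- **Sign-refined stage certificate**: any certificate of the threshold gate over a loaded region
whose input readouts have `c ≥ 0` has its tube refined by `c ≥ 0` (for `δ < σa₀²`). [folklore] -/
def posTrigger {τc : ℝ} {Ain Aout : Set (Fin 5 → ℝ)}
    (Cst : ReachCertificate (thresholdCircuit ε σ ν μ r κ) (preRegion a₀ R) δ τc Ain Aout)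
    (hσ : 0 ≤ σ) (ha₀ : 0 ≤ a₀) (hs : δ < σ * a₀ ^ 2) (hAin : Ain ⊆ trigNonneg) :
    ReachCertificate (thresholdCircuit ε σ ν μ r κ) (preRegion a₀ R) δ τc Ain Aout :=
  Cst.restrictConst trigNonneg isClosed_trigNonneg hAin (trigNonneg_cert hσ ha₀ hs hAin τc)

/-- The sign-refined tube (definitional unfolding). [folklore] -/
theorem posTrigger_tube {τc : ℝ} {Ain Aout : Set (Fin 5 → ℝ)}
    (Cst : ReachCertificate (thresholdCircuit ε σ ν μ r κ) (preRegion a₀ R) δ τc Ain Aout)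
    (hσ : 0 ≤ σ) (ha₀ : 0 ≤ a₀) (hs : δ < σ * a₀ ^ 2) (hAin : Ain ⊆ trigNonneg)
    (p : Fin 5 → ℝ) (s : ℝ) :
    (posTrigger Cst hσ ha₀ hs hAin).Tube p s = Cst.Tube p s ∩ trigNonneg := rfl

/-! ### §3. Joint closedness of the crossing boxes in (hand-off point, time, state) -/

/-- The crossing stage's box tubes, refined by a closed set `S`, have a graph that is JOINTLY closed
in (initial point `q ∈ K`, time `t ∈ [0, T]`, state) for every closed `K` — the hypothesis `hjoint`
of `ReachCertificate.comp`: each of the six box conditions is an inequality between functions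
jointly continuous in `(q, t, X)`. [folklore] -/
theorem isClosed_boxTube_joint (ε ν r δ a₀ R C T : ℝ) {K S : Set (Fin 5 → ℝ)} (hK : IsClosed K)
    (hS : IsClosed S) :
    IsClosed {z : (Fin 5 → ℝ) × (ℝ × (Fin 5 → ℝ)) | z.1 ∈ K ∧ z.2.1 ∈ Icc 0 T ∧
      z.2.2 ∈ boxTube ε ν r δ a₀ R C z.1 z.2.1 ∩ S} := by
  have hE : Continuous (energy : (Fin 5 → ℝ) → ℝ) := by unfold energy; fun_prop
  have hq : ∀ i : Fin 5, Continuous fun z : (Fin 5 → ℝ) × (ℝ × (Fin 5 → ℝ)) => z.1 i :=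
    fun i => (continuous_apply i).comp continuous_fst
  have ht : Continuous fun z : (Fin 5 → ℝ) × (ℝ × (Fin 5 → ℝ)) => z.2.1 :=
    continuous_fst.comp continuous_snd
  have hX : ∀ i : Fin 5, Continuous fun z : (Fin 5 → ℝ) × (ℝ × (Fin 5 → ℝ)) => z.2.2 i :=
    fun i => (continuous_apply i).comp (continuous_snd.comp continuous_snd)
  have hEq : Continuous fun z : (Fin 5 → ℝ) × (ℝ × (Fin 5 → ℝ)) => energy z.1 :=
    hE.comp continuous_fst
  have hEX : Continuous fun z : (Fin 5 → ℝ) × (ℝ × (Fin 5 → ℝ)) => energy z.2.2 :=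
    hE.comp (continuous_snd.comp continuous_snd)
  have hKz : IsClosed {z : (Fin 5 → ℝ) × (ℝ × (Fin 5 → ℝ)) | z.1 ∈ K} :=
    hK.preimage continuous_fst
  have hSz : IsClosed {z : (Fin 5 → ℝ) × (ℝ × (Fin 5 → ℝ)) | z.2.2 ∈ S} :=
    hS.preimage (continuous_snd.comp continuous_snd)
  have q1 := hq 1; have q3 := hq 3; have q4 := hq 4
  have x0 := hX 0; have x1 := hX 1; have x2 := hX 2; have x3 := hX 3; have x4 := hX 4
  have c0 : IsClosed {z : (Fin 5 → ℝ) × (ℝ × (Fin 5 → ℝ)) | a₀ ≤ z.2.2 0} :=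
    isClosed_le continuous_const x0
  have c1 : IsClosed {z : (Fin 5 → ℝ) × (ℝ × (Fin 5 → ℝ)) |
      z.1 1 - (ν * C ^ 2 + δ) * z.2.1 ≤ z.2.2 1} := isClosed_le (by fun_prop) x1
  have c2 : IsClosed {z : (Fin 5 → ℝ) × (ℝ × (Fin 5 → ℝ)) |
      z.2.2 1 ≤ z.1 1 + (ε * R ^ 2 + δ) * z.2.1} := isClosed_le x1 (by fun_prop)
  have c3 : IsClosed {z : (Fin 5 → ℝ) × (ℝ × (Fin 5 → ℝ)) | |z.2.2 2| ≤ C} :=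
    isClosed_le (by fun_prop) continuous_const
  have c4 : IsClosed {z : (Fin 5 → ℝ) × (ℝ × (Fin 5 → ℝ)) |
      Real.sqrt (z.2.2 3 ^ 2 + z.2.2 4 ^ 2) ≤
        Real.sqrt (z.1 3 ^ 2 + z.1 4 ^ 2) + (r * R * C + 2 * δ) * z.2.1} :=
    isClosed_le (by fun_prop) (by fun_prop)
  have c5 : IsClosed {z : (Fin 5 → ℝ) × (ℝ × (Fin 5 → ℝ)) |
      |energy z.2.2 - energy z.1| ≤ 10 * (δ * R) * z.2.1} :=
    isClosed_le (by fun_prop) (by fun_prop)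
  have tI : IsClosed {z : (Fin 5 → ℝ) × (ℝ × (Fin 5 → ℝ)) | z.2.1 ∈ Icc 0 T} :=
    isClosed_Icc.preimage ht
  have hB : IsClosed {z : (Fin 5 → ℝ) × (ℝ × (Fin 5 → ℝ)) |
      z.2.2 ∈ boxTube ε ν r δ a₀ R C z.1 z.2.1} :=
    c0.inter (c1.inter (c2.inter (c3.inter (c4.inter c5))))
  exact hKz.inter (tI.inter (hB.inter hSz))

/-! ### §4. Stages 1–2 composed over the energy ball -/

/-- The **sign-refined hand-off of the pre-threshold stage**: the end-of-stage tubes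
`preTube … p T₁`, `p ∈ Ain`, cut by `c ≥ 0`. [folklore] -/
def preHandoffPos (ε σ ν μ r δ a₀ R T₁ : ℝ) (Ain : Set (Fin 5 → ℝ)) : Set (Fin 5 → ℝ) :=
  {q | ∃ p ∈ Ain, q ∈ preTube ε σ ν μ r δ a₀ R T₁ p T₁ ∧ 0 ≤ q 2}

/-- The **sign-refined hand-off of the crossing stage** run from `Amid`: the end-of-stage boxes
`boxTube … q T₂`, `q ∈ Amid`, cut by `c ≥ 0` — the data of the ignition theorem
(`ThresholdIgnition.lean`: loaded `a ≥ a₁`, `0 ≤ c ≤ C`, clock past the band, energy bookkeeping).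
[folklore] -/
def crossHandoffPos (ε ν r δ a₁ R₁ C T₂ : ℝ) (Amid : Set (Fin 5 → ℝ)) : Set (Fin 5 → ℝ) :=
  {X | ∃ q ∈ Amid, X ∈ boxTube ε ν r δ a₁ R₁ C q T₂ ∧ 0 ≤ X 2}

/-- Points of the sign-refined pre-threshold hand-off have non-negative trigger. [folklore] -/
theorem preHandoffPos_subset_trigNonneg (ε σ ν μ r δ a₀ R T₁ : ℝ) (Ain : Set (Fin 5 → ℝ)) :
    preHandoffPos ε σ ν μ r δ a₀ R T₁ Ain ⊆ trigNonneg := fun _ ⟨_, _, _, h⟩ => h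

/-- The composed certificate's output region IS ignition data: loaded `a ≥ a₁`, trigger in
`[0, C]`. [folklore] -/
theorem crossHandoffPos_subset (ε ν r δ a₁ R₁ C T₂ : ℝ) (Amid : Set (Fin 5 → ℝ)) :
    crossHandoffPos ε ν r δ a₁ R₁ C T₂ Amid ⊆ {X | a₁ ≤ X 0 ∧ 0 ≤ X 2 ∧ X 2 ≤ C} := by
  rintro X ⟨q, _, hX, hc⟩
  exact ⟨hX.1, hc, (le_abs_self _).trans hX.2.2.2.1⟩

/-- **Stage 1 over the energy ball**: the pre-threshold certificate refined by `c ≥ 0`,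
retargeted to its sign-refined hand-off, and moved from the loaded region `preRegion a₀ R` (open)
to `modeBall Rb`, `R ≤ Rb`, by the continuation principle. [folklore] -/
def preStageBall (ε σ ν μ r κ δ a₀ R T₁ Rb : ℝ) (Ain : Set (Fin 5 → ℝ))
    (hε : 0 ≤ ε) (hσ : 0 ≤ σ) (hν : 0 ≤ ν) (hμ : 0 ≤ μ) (hr : 0 ≤ r) (hδ : 0 ≤ δ)
    (hR : 0 ≤ R) (ha₀ : 0 ≤ a₀) (hs : δ < σ * a₀ ^ 2) (hT₁ : 0 < T₁) (hRb : R ≤ Rb)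
    (hAin0 : Ain ⊆ trigNonneg)
    (hAin₁ : ∀ p ∈ Ain, a₀ ≤ p 0 ∧ 0 < preMargin ε ν μ δ a₀ R T₁ p)
    (hsub₁ : ∀ p ∈ Ain, ∀ t ∈ Icc 0 T₁, preTube ε σ ν μ r δ a₀ R T₁ p t ⊆ preRegion a₀ R) :
    ReachCertificate (thresholdCircuit ε σ ν μ r κ) (modeBall Rb) δ T₁ Ain
      (preHandoffPos ε σ ν μ r δ a₀ R T₁ Ain) :=
  ((posTrigger (preThresholdCertificate ε σ ν μ r κ δ a₀ R T₁ Ain hε hσ hν hμ hr hδ hR hT₁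
      hAin₁ hsub₁) hσ ha₀ hs hAin0).withHandoff hT₁.le (preHandoffPos ε σ ν μ r δ a₀ R T₁ Ain)
      (by
        intro p hp X hX
        rw [posTrigger_tube, preThresholdCertificate_tube] at hX
        exact ⟨p, hp, hX.1, hX.2⟩)).enlarge
    (isOpen_preRegion a₀ R) ((preRegion_subset_modeBall a₀ R).trans (modeBall_mono hRb))

/-- Its tube: the pre-threshold tube cut by `c ≥ 0` (definitional unfolding). [folklore] -/
theorem preStageBall_tube (ε σ ν μ r κ δ a₀ R T₁ Rb : ℝ) (Ain : Set (Fin 5 → ℝ))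
    (hε : 0 ≤ ε) (hσ : 0 ≤ σ) (hν : 0 ≤ ν) (hμ : 0 ≤ μ) (hr : 0 ≤ r) (hδ : 0 ≤ δ)
    (hR : 0 ≤ R) (ha₀ : 0 ≤ a₀) (hs : δ < σ * a₀ ^ 2) (hT₁ : 0 < T₁) (hRb : R ≤ Rb)
    (hAin0 : Ain ⊆ trigNonneg)
    (hAin₁ : ∀ p ∈ Ain, a₀ ≤ p 0 ∧ 0 < preMargin ε ν μ δ a₀ R T₁ p)
    (hsub₁ : ∀ p ∈ Ain, ∀ t ∈ Icc 0 T₁, preTube ε σ ν μ r δ a₀ R T₁ p t ⊆ preRegion a₀ R)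
    (p : Fin 5 → ℝ) (s : ℝ) :
    (preStageBall ε σ ν μ r κ δ a₀ R T₁ Rb Ain hε hσ hν hμ hr hδ hR ha₀ hs hT₁ hRb hAin0 hAin₁
      hsub₁).Tube p s = preTube ε σ ν μ r δ a₀ R T₁ p s ∩ trigNonneg := rfl

/-- **Stage 2 over the energy ball** from any input region `Amid` of non-negative trigger: the
crossing certificate over the (thin) loaded region `preRegion a₁ R₁` refined by `c ≥ 0`,
retargeted to its sign-refined hand-off boxes, moved to `modeBall Rb`, `R₁ ≤ Rb`. [folklore] -/
def crossStageBall (ε σ ν μ r κ δ a₁ R₁ C Λ T₂ Rb : ℝ) (Amid : Set (Fin 5 → ℝ))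
    (hε : 0 ≤ ε) (hσ : 0 ≤ σ) (hν : 0 ≤ ν) (hμ : 0 ≤ μ) (hr : 0 ≤ r) (hδ : 0 ≤ δ)
    (ha₁ : 0 ≤ a₁) (hs₁ : δ < σ * a₁ ^ 2) (hT₂ : 0 < T₂) (hΛ : 0 ≤ Λ) (hR₁b : R₁ ≤ Rb)
    (hAmid0 : Amid ⊆ trigNonneg)
    (hAin₂ : ∀ q ∈ Amid, a₁ ≤ q 0 ∧
      ν * (q 1 + (ε * R₁ ^ 2 + δ) * T₂) - μ * a₁ ≤ Λ ∧
      μ * R₁ - ν * (q 1 - (ν * C ^ 2 + δ) * T₂) ≤ Λ ∧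
      (|q 2| + (σ * R₁ ^ 2 + δ) * T₂) * Real.exp (Λ * T₂) < C)
    (hsub₂ : ∀ q ∈ Amid, ∀ t ∈ Icc 0 T₂, boxTube ε ν r δ a₁ R₁ C q t ⊆ preRegion a₁ R₁) :
    ReachCertificate (thresholdCircuit ε σ ν μ r κ) (modeBall Rb) δ T₂ Amid
      (crossHandoffPos ε ν r δ a₁ R₁ C T₂ Amid) :=
  ((posTrigger (crossingCertificate ε σ ν μ r κ δ a₁ R₁ C Λ T₂ Amid hε hσ hν hμ hr hδ hT₂ hΛ
      hAin₂ hsub₂) hσ ha₁ hs₁ hAmid0).withHandoff hT₂.le (crossHandoffPos ε ν r δ a₁ R₁ C T₂ Amid)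
      (by
        intro q hq X hX
        rw [posTrigger_tube, crossingCertificate_tube] at hX
        exact ⟨q, hq, hX.1, hX.2⟩)).enlarge
    (isOpen_preRegion a₁ R₁) ((preRegion_subset_modeBall a₁ R₁).trans (modeBall_mono hR₁b))

/-- Its tube: the crossing box cut by `c ≥ 0` (definitional unfolding). [folklore] -/
theorem crossStageBall_tube (ε σ ν μ r κ δ a₁ R₁ C Λ T₂ Rb : ℝ) (Amid : Set (Fin 5 → ℝ))
    (hε : 0 ≤ ε) (hσ : 0 ≤ σ) (hν : 0 ≤ ν) (hμ : 0 ≤ μ) (hr : 0 ≤ r) (hδ : 0 ≤ δ)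
    (ha₁ : 0 ≤ a₁) (hs₁ : δ < σ * a₁ ^ 2) (hT₂ : 0 < T₂) (hΛ : 0 ≤ Λ) (hR₁b : R₁ ≤ Rb)
    (hAmid0 : Amid ⊆ trigNonneg)
    (hAin₂ : ∀ q ∈ Amid, a₁ ≤ q 0 ∧
      ν * (q 1 + (ε * R₁ ^ 2 + δ) * T₂) - μ * a₁ ≤ Λ ∧
      μ * R₁ - ν * (q 1 - (ν * C ^ 2 + δ) * T₂) ≤ Λ ∧
      (|q 2| + (σ * R₁ ^ 2 + δ) * T₂) * Real.exp (Λ * T₂) < C)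
    (hsub₂ : ∀ q ∈ Amid, ∀ t ∈ Icc 0 T₂, boxTube ε ν r δ a₁ R₁ C q t ⊆ preRegion a₁ R₁)
    (q : Fin 5 → ℝ) (s : ℝ) :
    (crossStageBall ε σ ν μ r κ δ a₁ R₁ C Λ T₂ Rb Amid hε hσ hν hμ hr hδ ha₁ hs₁ hT₂ hΛ hR₁b
      hAmid0 hAin₂ hsub₂).Tube q s = boxTube ε ν r δ a₁ R₁ C q s ∩ trigNonneg := rfl

/-- **Stages 1–2 of the threshold gate as ONE certificate over the energy ball.** Pre-threshold
stage (length `T₁`, loaded region `preRegion a₀ R`, margin/energy hypotheses as in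
`preThresholdCertificate`) refined by `c ≥ 0`, then crossing stage (length `T₂`, thin loaded region
`preRegion a₁ R₁`, band rate `Λ`, trigger level `C`, hypotheses as in `crossingCertificate` but
required at every point of the stage-1 sign-refined hand-off) refined by `c ≥ 0`; both moved to
the energy ball `modeBall Rb` (`R, R₁ ≤ Rb`) and composed by `ReachCertificate.comp`, whose seam
conditions are discharged here: hand-off by construction, compact hand-off tubes
(`isCompact_preTube`), jointly closed boxes (`isClosed_boxTube_joint`). The result is a
`ReachCertificate` of length `T₁ + T₂` from `Ain` to the ignition data
`crossHandoffPos … (preHandoffPos … Ain)`. [cite: Tao2016AveragedNS, §5.5 Thm 5.3 (5.5)] -/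
def preCrossCertificate (ε σ ν μ r κ δ a₀ R T₁ a₁ R₁ C Λ T₂ Rb : ℝ) (Ain : Set (Fin 5 → ℝ))
    (hε : 0 ≤ ε) (hσ : 0 ≤ σ) (hν : 0 ≤ ν) (hμ : 0 ≤ μ) (hr : 0 ≤ r) (hδ : 0 ≤ δ)
    (hR : 0 ≤ R) (ha₀ : 0 ≤ a₀) (ha₁ : 0 ≤ a₁) (hs : δ < σ * a₀ ^ 2) (hs₁ : δ < σ * a₁ ^ 2)
    (hT₁ : 0 < T₁) (hT₂ : 0 < T₂) (hΛ : 0 ≤ Λ) (hRb : R ≤ Rb) (hR₁b : R₁ ≤ Rb)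
    (hAin0 : Ain ⊆ trigNonneg)
    (hAin₁ : ∀ p ∈ Ain, a₀ ≤ p 0 ∧ 0 < preMargin ε ν μ δ a₀ R T₁ p)
    (hsub₁ : ∀ p ∈ Ain, ∀ t ∈ Icc 0 T₁, preTube ε σ ν μ r δ a₀ R T₁ p t ⊆ preRegion a₀ R)
    (hAin₂ : ∀ q ∈ preHandoffPos ε σ ν μ r δ a₀ R T₁ Ain, a₁ ≤ q 0 ∧
      ν * (q 1 + (ε * R₁ ^ 2 + δ) * T₂) - μ * a₁ ≤ Λ ∧
      μ * R₁ - ν * (q 1 - (ν * C ^ 2 + δ) * T₂) ≤ Λ ∧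
      (|q 2| + (σ * R₁ ^ 2 + δ) * T₂) * Real.exp (Λ * T₂) < C)
    (hsub₂ : ∀ q ∈ preHandoffPos ε σ ν μ r δ a₀ R T₁ Ain, ∀ t ∈ Icc 0 T₂,
      boxTube ε ν r δ a₁ R₁ C q t ⊆ preRegion a₁ R₁) :
    ReachCertificate (thresholdCircuit ε σ ν μ r κ) (modeBall Rb) δ (T₁ + T₂) Ain
      (crossHandoffPos ε ν r δ a₁ R₁ C T₂ (preHandoffPos ε σ ν μ r δ a₀ R T₁ Ain)) :=
  (preStageBall ε σ ν μ r κ δ a₀ R T₁ Rb Ain hε hσ hν hμ hr hδ hR ha₀ hs hT₁ hRb hAin0 hAin₁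
      hsub₁).comp
    (crossStageBall ε σ ν μ r κ δ a₁ R₁ C Λ T₂ Rb (preHandoffPos ε σ ν μ r δ a₀ R T₁ Ain)
      hε hσ hν hμ hr hδ ha₁ hs₁ hT₂ hΛ hR₁b (preHandoffPos_subset_trigNonneg ε σ ν μ r δ a₀ R T₁ Ain)
      hAin₂ hsub₂)
    hT₁.le hT₂
    (by
      intro p hp X hX
      rw [preStageBall_tube] at hX
      exact ⟨p, hp, hX.1, hX.2⟩)
    (by
      intro p _
      rw [preStageBall_tube]
      exact (isCompact_preTube T₁ T₁ p).inter_right isClosed_trigNonneg)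
    (by
      intro p _
      simp only [preStageBall_tube, crossStageBall_tube]
      exact isClosed_boxTube_joint ε ν r δ a₁ R₁ C T₂
        ((isClosed_preTube T₁ T₁ p).inter isClosed_trigNonneg) isClosed_trigNonneg)

/-- **REACH content of the composed certificate, with no region hypothesis**: every continuous
curve from `p ∈ Ain` with `δ`-admissible right derivative for the threshold gate on
`[0, T₁ + T₂)` passes through a sign-refined crossing box run from a point of the sign-refined
pre-threshold hand-off of `Ain` — the ignition data — by the final time. [folklore] -/
theorem preCrossCertificate_reach (ε σ ν μ r κ δ a₀ R T₁ a₁ R₁ C Λ T₂ Rb : ℝ)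
    (Ain : Set (Fin 5 → ℝ))
    (hε : 0 ≤ ε) (hσ : 0 ≤ σ) (hν : 0 ≤ ν) (hμ : 0 ≤ μ) (hr : 0 ≤ r) (hδ : 0 ≤ δ)
    (hR : 0 ≤ R) (ha₀ : 0 ≤ a₀) (ha₁ : 0 ≤ a₁) (hs : δ < σ * a₀ ^ 2) (hs₁ : δ < σ * a₁ ^ 2)
    (hT₁ : 0 < T₁) (hT₂ : 0 < T₂) (hΛ : 0 ≤ Λ) (hRb : R ≤ Rb) (hR₁b : R₁ ≤ Rb)
    (hAin0 : Ain ⊆ trigNonneg)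
    (hAin₁ : ∀ p ∈ Ain, a₀ ≤ p 0 ∧ 0 < preMargin ε ν μ δ a₀ R T₁ p)
    (hsub₁ : ∀ p ∈ Ain, ∀ t ∈ Icc 0 T₁, preTube ε σ ν μ r δ a₀ R T₁ p t ⊆ preRegion a₀ R)
    (hAin₂ : ∀ q ∈ preHandoffPos ε σ ν μ r δ a₀ R T₁ Ain, a₁ ≤ q 0 ∧
      ν * (q 1 + (ε * R₁ ^ 2 + δ) * T₂) - μ * a₁ ≤ Λ ∧
      μ * R₁ - ν * (q 1 - (ν * C ^ 2 + δ) * T₂) ≤ Λ ∧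
      (|q 2| + (σ * R₁ ^ 2 + δ) * T₂) * Real.exp (Λ * T₂) < C)
    (hsub₂ : ∀ q ∈ preHandoffPos ε σ ν μ r δ a₀ R T₁ Ain, ∀ t ∈ Icc 0 T₂,
      boxTube ε ν r δ a₁ R₁ C q t ⊆ preRegion a₁ R₁)
    {p : Fin 5 → ℝ} (hp : p ∈ Ain) {x : ℝ → Fin 5 → ℝ} (hx0 : x 0 = p)
    (hcont : ContinuousOn x (Icc 0 (T₁ + T₂)))
    (hder : ∀ s ∈ Ico 0 (T₁ + T₂), ∃ W : Fin 5 → ℝ, HasDerivWithinAt x W (Ici s) s ∧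
      ‖W - thresholdCircuit ε σ ν μ r κ (x s)‖ ≤ δ) :
    ∃ s ∈ Icc 0 (T₁ + T₂),
      x s ∈ crossHandoffPos ε ν r δ a₁ R₁ C T₂ (preHandoffPos ε σ ν μ r δ a₀ R T₁ Ain) :=
  (preCrossCertificate ε σ ν μ r κ δ a₀ R T₁ a₁ R₁ C Λ T₂ Rb Ain hε hσ hν hμ hr hδ hR ha₀ ha₁ hs
    hs₁ hT₁ hT₂ hΛ hRb hR₁b hAin0 hAin₁ hsub₁ hAin₂ hsub₂).reach (isOpen_modeBall Rb) hp
    (by positivity) hx0 hcont hder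

end Literature.Analysis.FluidPDE.FluidComputer

end
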